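import Summits.CriticalPhenomena.SAWScalingLimit.Theorems.SAWDevelopingMapHexConjectureKPRenewalSplit
import Summits.CriticalPhenomena.SAWScalingLimit.Theorems.SAWDevelopingMapHexConjectureKPTriangleTwo
import HarnessLib

/-!
# Crux `HexConjecture` (stmt-CriticalPhenomena-0808), line `root-locality-replaces-loewner`:
the weighted renewal bound (Krachun–Panagiotis, Lemma 3.1) and its Markov corollary

Landing target:
`Summits/CriticalPhenomena/SAWScalingLimit/Theorems/SAWDevelopingMapHexConjectureKPRenewalBound.lean`
(`--supports stmt-CriticalPhenomena-0808`; registered sub-goal `stub_kp_renewal_bound`).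

Krachun–Panagiotis, Lemma 3.1 (arXiv:2310.17299, p. 9): for the walks `γ` of the triangle
`Tria_{2k+1} = T_k` from the root mid-edge to its right side, weighted by `x_c^{ℓ(γ)}`, the number
`N(γ)` of renewal times satisfies `Σ_γ x_c^{ℓ(γ)} N(γ) ≤ Σ_{i=0}^{k} Δ_{k,i} B_{k-i} ≤ Σ_i D_{2i+1} B_{k-i}`
("`P[i is a renewal time] ≤ D_{2i+1} B_{k-i} / D_{2k+1}` … summing over all `i`").  In the tree's
vocabulary (`…KPDefs.lean`): `Σ_{P ∈ rightWalks k} x_c^{ℓ(P)} · renewals k P ≤ renBound k` with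
`renBound k = Σ_{i ≤ k} 2·triDl i · (2cos(π/8)·triDl ⌊(k-i-1)/2⌋)`.  The proof, as printed:

* `renewals k P = #{i ≤ k : crossCount i P = 1}`, so the weighted count is the sum over `i ≤ k` of the
  masses of the right walks crossing the line `slev = i ∣ i+1` exactly once (`renBound_sum_renewals_eq`);
* for each `i ≤ k` such a walk splits at its crossing (`stub_kp_renewal_split`, landed) into a right
  exit `Q` of the off-centred triangle `T_{k,i}` and a (normalised) bridge `S` of the strip `S_{k-i,3k}`,
  with `ℓ(Q) + ℓ(S) = ℓ(P)` and `P` recovered from `(Q, S)`; the split is therefore a weight-preserving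
  injection and the mass is at most `triDr₂ k i · B_{k-i,3k}(x_c)` (`renBound_sum_cross_le`);
* `triDr₂ k i ≤ Δ_{k,i} ≤ D_{2i+1} = 2·triDl i` (`triD₂_le`, landed) and
  `B_{k-i,3k} ≤ cos(π/8) D_{k-i} = 2cos(π/8)·triDl ⌊(k-i-1)/2⌋` (Glazman–Manolescu's (4.1),
  `HV.stripB_le_triDl`, for `i < k`; for `i = k` the strip `S_0` carries only the trivial walk,
  `B_0 = 1 = 2 x_c cos(π/8) ≤ 2cos(π/8)·triDl 0`) (`renBound_stripB_le`);
* Markov's inequality for the sub-probability weights `x_c^{ℓ(P)}` (`renBound_markov`).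

Sources: Krachun–Panagiotis (arXiv:2310.17299) §3.1, Lemma 3.1; Glazman–Manolescu 2020, Lemma 4.1,
eq. (4.1); Duminil-Copin–Smirnov 2012 §3 (strips and bridges).
-/

noncomputable section

open scoped Classical
open Finset
open Literature.Probability.RandomPlanarGeometry.SAW Literature.Probability.RandomPlanarGeometry.SAW.HV

namespace Summit.CriticalPhenomena.SAWScalingLimit.Theorems.HexConjecture.RootLocality

/-! ### The weighted renewal count as a sum over the lines `slev = i ∣ i+1` -/

/-- `Σ_γ x_c^{ℓ(γ)} N(γ) = Σ_{i=0}^{k} Σ_{γ : i renewal} x_c^{ℓ(γ)}` ("we estimate the probability that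
`i` is a renewal time … summing over all `i`"). [cite: KrachunPanagiotis2026, Lemma 3.1 (proof)] -/
theorem renBound_sum_renewals_eq (k : ℕ) :
    ∑ P ∈ rightWalks k, hexCriticalFugacity ^ mwLen P * (renewals k P : ℝ) =
      ∑ i ∈ range (k + 1), ∑ P ∈ (rightWalks k).filter (fun P => crossCount (i : ℤ) P = 1),
        hexCriticalFugacity ^ mwLen P := by
  have e : ∀ P : List HV, hexCriticalFugacity ^ mwLen P * (renewals k P : ℝ) =
      ∑ i ∈ range (k + 1),
        if crossCount (i : ℤ) P = 1 then hexCriticalFugacity ^ mwLen P else 0 := by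
    intro P
    rw [renewals, Finset.card_filter, Nat.cast_sum, Finset.mul_sum]
    refine Finset.sum_congr rfl fun i _ => ?_
    split_ifs <;> simp
  rw [Finset.sum_congr rfl fun P _ => e P, Finset.sum_comm]
  refine Finset.sum_congr rfl fun i _ => ?_
  rw [Finset.sum_filter]

/-! ### One line: the split injection into (right exits of `T_{k,i}`) × (bridges of `S_{k-i}`) -/

/-- The split `P ↦ (Q, S)` at a renewal crossing is injective: `P` is recovered by gluing `S`, placed by
the attachment automorphism at the final dart of `Q`, after `Q`. [cite: KrachunPanagiotis2026, Lemma 3.1 (proof, Fig. 3)] -/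
theorem renBound_split_injOn {s : Finset (List HV)} {fQ fS : List HV → List HV}
    {fx fy : List HV → ℤ}
    (hfd : ∀ P ∈ s, finalDart (fQ P) = ((fx P, fy P, false), (fx P, fy P, true)))
    (hPe : ∀ P ∈ s, P = fQ P ++ (((fS P).map (attach (fx P) (fy P))).drop 2)) :
    Set.InjOn (fun P => (fQ P, fS P)) (s : Set (List HV)) := by
  intro P hP P' hP' he
  rw [Finset.mem_coe] at hP hP'
  obtain ⟨hQ, hS⟩ := Prod.mk_inj.1 he
  have h1 := hfd P hP
  rw [hQ, hfd P' hP'] at h1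
  obtain ⟨h11, -⟩ := Prod.mk_inj.1 h1
  obtain ⟨hx, h12⟩ := Prod.mk_inj.1 h11
  obtain ⟨hy, -⟩ := Prod.mk_inj.1 h12
  rw [hPe P hP, hPe P' hP', hQ, hS, hx, hy]

/-- **`Σ_{γ : i renewal} x_c^{ℓ(γ)} ≤ Δ_{k,i} · B_{k-i}`** in finite volume: the mass of the right walks of
`T_k` crossing the line `slev = i ∣ i+1` exactly once is at most `triDr₂ k i · B_{k-i,3k}(x_c)` ("the
sub-walk of γ from `x` until its endpoint is … a bridge within Strip_{k−i}; whilst the sub-walk of γ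
from `0` to `x` lies in the triangle `T_{k,i}`"). [cite: KrachunPanagiotis2026, Lemma 3.1 (proof)] -/
theorem renBound_sum_cross_le {k i : ℕ} (hik : i ≤ k) :
    ∑ P ∈ (rightWalks k).filter (fun P => crossCount (i : ℤ) P = 1), hexCriticalFugacity ^ mwLen P ≤
      triDr₂ k i * stripB (k - i) (3 * k) hexCriticalFugacity := by
  have hsplit : ∀ P ∈ (rightWalks k).filter (fun P => crossCount (i : ℤ) P = 1),
      ∃ (Q S : List HV) (x₀ x₁ : ℤ), x₀ + x₁ = i ∧ 0 ≤ x₁ ∧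
        Q ∈ (midWalks (triV₂ k i)).filter (fun Q => IsRightDart i (finalDart Q)) ∧
        finalDart Q = ((x₀, x₁, false), (x₀, x₁, true)) ∧
        S ∈ (midWalks (stripV (k - i) (3 * k))).filter
          (fun S => IsBetaDart (k - i) (finalDart S)) ∧
        mwLen Q + mwLen S = mwLen P ∧ P = Q ++ ((S.map (attach x₀ x₁)).drop 2) := by
    intro P hP
    rw [mem_filter] at hP
    exact stub_kp_renewal_split k P hP.1 i hik hP.2
  choose! fQ fS fx fy hspec using hsplit
  have h0 := hexCriticalFugacity_pos_lt_one.1.le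
  have hinj := renBound_split_injOn (fun P hP => (hspec P hP).2.2.2.1)
    (fun P hP => (hspec P hP).2.2.2.2.2.2)
  have hmaps : ∀ P ∈ (rightWalks k).filter (fun P => crossCount (i : ℤ) P = 1),
      (fQ P, fS P) ∈ ((midWalks (triV₂ k i)).filter (fun Q => IsRightDart i (finalDart Q))) ×ˢ
        ((midWalks (stripV (k - i) (3 * k))).filter
          (fun S => IsBetaDart (k - i) (finalDart S))) := fun P hP =>
    Finset.mem_product.2 ⟨(hspec P hP).2.2.1, (hspec P hP).2.2.2.2.1⟩
  have key := sum_le_sum_of_injOn_of_nonneg (fun P => (fQ P, fS P)) hinj hmaps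
    (fun p : List HV × List HV => hexCriticalFugacity ^ mwLen p.1 * hexCriticalFugacity ^ mwLen p.2)
    (fun _ _ => mul_nonneg (pow_nonneg h0 _) (pow_nonneg h0 _))
  simp only [Finset.sum_product] at key
  rw [triDr₂, stripB, Finset.sum_mul_sum]
  refine le_trans (le_of_eq (Finset.sum_congr rfl fun P hP => ?_)) key
  rw [← pow_add, (hspec P hP).2.2.2.2.2.1]

/-! ### The two factors: `Δ_{k,i} ≤ D_{2i+1}` and `B_{k-i} ≤ cos(π/8) D_{k-i}` -/

/-- `triDr₂ k i ≤ Δ_{k,i} ≤ D_{2i+1} = 2·triDl i`. [cite: KrachunPanagiotis2026, Lemma 3.1 (proof, Δ_{k,i} ≤ D_{2i+1})] -/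
theorem renBound_triDr₂_le {k i : ℕ} (hik : i ≤ k) : triDr₂ k i ≤ 2 * triDl i := by
  have h := triD₂_le hik
  have h0 : 0 ≤ triDl₂ k i :=
    sum_nonneg fun _ _ => pow_nonneg hexCriticalFugacity_pos_lt_one.1.le _
  linarith

/-- The strip `S_{0,L}` has no vertex, so its only walk from `a` is the trivial one.
[cite: DuminilCopinSmirnov2012, §3 (S_{T,L})] -/
theorem renBound_midWalks_stripV_zero (L : ℕ) : midWalks (stripV 0 L) = {[wOut, hvOrigin]} := by
  ext P
  rw [mem_midWalks_iff, mem_singleton]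
  constructor
  · intro hP
    rcases hP.trivial_or_exists with h | ⟨l, u, hl, rfl⟩
    · exact h
    · exfalso
      obtain ⟨v, hv⟩ := List.exists_mem_of_ne_nil l hl
      have hV := hP.2.2.2.1 v (by rw [inner_cons_append]; exact hv)
      rw [mem_stripV_iff] at hV
      obtain ⟨a, b, c⟩ := v
      obtain ⟨h1, h2, -, -⟩ := hV
      cases c <;> simp [lev, bit] at h1 h2 <;> omega
  · rintro rfl
    exact isMidWalk_trivial _

/-- `B_0 = 1`: the bridge partition function of the strip of width `0` counts only the trivial walk
(Krachun–Panagiotis's convention `B_0 = cos(π/8) D_0 = 1`). [cite: KrachunPanagiotis2026, Definition 2.3 (B_0, D_0)] -/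
theorem renBound_stripB_zero (L : ℕ) (x : ℝ) : stripB 0 L x = 1 := by
  rw [stripB, renBound_midWalks_stripV_zero, Finset.filter_singleton, if_pos (by decide),
    sum_singleton, mwLen_trivial, pow_zero]

/-- `x_c ≤ triDl 0`: the one-step walk from `a` through `O` out of the left side of `T_0 = {O}`.
[cite: GlazmanManolescu2019, §4.1 (T_L)] -/
theorem renBound_xc_le_triDl_zero : hexCriticalFugacity ≤ triDl 0 := by
  have hW : IsMidWalk (triV 0) (wOut :: ([hvOrigin] ++ [((-1 : ℤ), (0 : ℤ), true)])) := by
    rw [isMidWalk_cons_append_iff (triV 0) (List.cons_ne_nil _ _)]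
    refine ⟨List.isChain_singleton _, rfl, by decide, ?_, List.nodup_singleton _, by decide⟩
    intro x hx
    rw [List.mem_singleton] at hx
    rw [hx]
    exact hvOrigin_mem_triV 0
  have hmem : [wOut, hvOrigin, ((-1 : ℤ), (0 : ℤ), true)] ∈
      (midWalks (triV 0)).filter (fun P => IsLeftDart 0 (finalDart P)) := by
    rw [mem_filter, mem_midWalks_iff]
    exact ⟨hW, by decide⟩
  have h1 : hexCriticalFugacity =
      hexCriticalFugacity ^ mwLen [wOut, hvOrigin, ((-1 : ℤ), (0 : ℤ), true)] := by
    rw [show mwLen [wOut, hvOrigin, ((-1 : ℤ), (0 : ℤ), true)] = 1 from rfl, pow_one]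
  rw [triDl]
  exact h1.trans_le (Finset.single_le_sum (f := fun P => hexCriticalFugacity ^ mwLen P)
    (fun _ _ => pow_nonneg hexCriticalFugacity_pos_lt_one.1.le _) hmem)

/-- `1 = B_0 ≤ cos(π/8) D_0`, i.e. `1 = 2 x_c cos(π/8) ≤ 2cos(π/8)·triDl 0`.
[cite: KrachunPanagiotis2026, proof of Lemma 2.3 ("B_0 = cos(π/8) D_0 by definition")] -/
theorem renBound_one_le : 1 ≤ 2 * Real.cos (Real.pi / 8) * triDl 0 := by
  have hc := cos_pi_div_eight_pos
  calc (1 : ℝ) = 2 * Real.cos (Real.pi / 8) * hexCriticalFugacity := by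
        rw [← two_mul_xc_mul_cos]; ring
    _ ≤ 2 * Real.cos (Real.pi / 8) * triDl 0 :=
        mul_le_mul_of_nonneg_left renBound_xc_le_triDl_zero (mul_nonneg zero_le_two hc.le)

/-- **`B_{k-i} ≤ cos(π/8) D_{k-i}`** in the tree's vocabulary: `B_{k-i,3k}(x_c) ≤ 2cos(π/8)·triDl ⌊(k-i-1)/2⌋`
(Glazman–Manolescu's (4.1) for `i < k`; the trivial strip for `i = k`).
[cite: KrachunPanagiotis2026, Lemma 2.3 and Lemma 3.1 (proof, "B_{k-i} ≤ cos(π/8) D_{k-i}")] -/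
theorem renBound_stripB_le {k i : ℕ} (hik : i ≤ k) :
    stripB (k - i) (3 * k) hexCriticalFugacity ≤
      2 * Real.cos (Real.pi / 8) * triDl ((k - i - 1) / 2) := by
  rcases hik.lt_or_eq with h | rfl
  · exact stripB_le_triDl (by omega) _
  · rw [Nat.sub_self, renBound_stripB_zero]
    simp only [Nat.zero_sub, Nat.zero_div]
    exact renBound_one_le

/-! ### Lemma 3.1 and its Markov corollary -/

/-- **Krachun–Panagiotis, Lemma 3.1** (weighted form): `Σ_γ x_c^{ℓ(γ)} N(γ) ≤ Σ_{i=0}^{k} D_{2i+1} B_{k-i}`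
`≤ renBound k`. [cite: KrachunPanagiotis2026, Lemma 3.1] -/
theorem renBound_sum_renewals_le (k : ℕ) :
    ∑ P ∈ rightWalks k, hexCriticalFugacity ^ mwLen P * (renewals k P : ℝ) ≤ renBound k := by
  rw [renBound_sum_renewals_eq, renBound]
  refine Finset.sum_le_sum fun i hi => ?_
  rw [Finset.mem_range] at hi
  have hik : i ≤ k := by omega
  refine (renBound_sum_cross_le hik).trans ?_
  exact mul_le_mul (renBound_triDr₂_le hik) (renBound_stripB_le hik)
    (stripB_nonneg hexCriticalFugacity_pos_lt_one.1.le) (mul_nonneg zero_le_two (triDl_nonneg i))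

/-- **Markov's inequality for the renewal count**: the right walks of `T_k` with more than `M`
renewal times weigh at most `renBound k / M` ("there exists `M_k ≤ 8 E[N]` such that
`P[N > M_k] ≤ 1/8`"). [cite: KrachunPanagiotis2026, §3.2 (M_k, Markov)] -/
theorem renBound_markov (k : ℕ) {M : ℝ} (hM : 0 < M) :
    ∑ P ∈ (rightWalks k).filter (fun P => M < (renewals k P : ℝ)), hexCriticalFugacity ^ mwLen P ≤
      renBound k / M := by
  have h0 := hexCriticalFugacity_pos_lt_one.1.le
  rw [le_div_iff₀ hM, Finset.sum_mul]
  calc ∑ P ∈ (rightWalks k).filter (fun P => M < (renewals k P : ℝ)),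
        hexCriticalFugacity ^ mwLen P * M
      ≤ ∑ P ∈ (rightWalks k).filter (fun P => M < (renewals k P : ℝ)),
          hexCriticalFugacity ^ mwLen P * (renewals k P : ℝ) := by
        refine Finset.sum_le_sum fun P hP => ?_
        rw [mem_filter] at hP
        exact mul_le_mul_of_nonneg_left hP.2.le (pow_nonneg h0 _)
    _ ≤ ∑ P ∈ rightWalks k, hexCriticalFugacity ^ mwLen P * (renewals k P : ℝ) :=
        Finset.sum_le_sum_of_subset_of_nonneg (filter_subset _ _) fun P _ _ =>
          mul_nonneg (pow_nonneg h0 _) (Nat.cast_nonneg _)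
    _ ≤ renBound k := renBound_sum_renewals_le k

/-- **Registered sub-goal `stub_kp_renewal_bound`** (crux item stmt-CriticalPhenomena-0808, line
`root-locality-replaces-loewner`; Krachun–Panagiotis, Lemma 3.1 with Markov): over the walks of the
triangle `T_k` from `a` to its right side, the `x_c`-weighted number of renewal times is at most
`renBound k = Σ_{i ≤ k} 2·triDl i · 2cos(π/8)·triDl ⌊(k-i-1)/2⌋` (`= Σ_i D_{2i+1} · cos(π/8) D_{k-i}`), and
for every `M > 0` the walks with more than `M` renewal times weigh at most `renBound k / M`.
[cite: KrachunPanagiotis2026, Lemma 3.1 and §3.2 (M_k)] -/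
theorem stub_kp_renewal_bound : ∀ (k : ℕ), (∑ P ∈ rightWalks k, Literature.Probability.RandomPlanarGeometry.SAW.hexCriticalFugacity ^ Literature.Probability.RandomPlanarGeometry.SAW.HV.mwLen P * (renewals k P : ℝ) ≤ renBound k) ∧ ∀ (M : ℝ), 0 < M → ∑ P ∈ (rightWalks k).filter (fun P => M < (renewals k P : ℝ)), Literature.Probability.RandomPlanarGeometry.SAW.hexCriticalFugacity ^ Literature.Probability.RandomPlanarGeometry.SAW.HV.mwLen P ≤ renBound k / M :=
  fun k => ⟨renBound_sum_renewals_le k, fun _ hM => renBound_markov k hM⟩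

end Summit.CriticalPhenomena.SAWScalingLimit.Theorems.HexConjecture.RootLocality

end
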